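import Summits.NavierStokesRegularity.FluidComputer.GateBudgetPhaseWeight
import HarnessLib

/-!
# GateBudget part 79 — the fine transfer law of a pinned lattice pulse (§233–§234)

Cell `pub-fluidc`, blueprint seat bp1 (gen 36, sixth item: THE d-LEDGER II, SPEC-INPUT-bp1
§BJ/§BK); namespace `Summit.NavierStokesRegularity.FluidComputer.GateBudget`, two-scale
family `RotorKnob.rotorCircuit K M ε ρ` from `delayInit` (§233 holds for every member with
`K, ε ≥ 0`; §234 for the headline member `M = K¹⁰`, `K ≥ 16`, on the lattice `ε = kK¹⁰ρ²`).
HONEST FRAMING: a low prior, high value-of-information experiment on Tao's machine paradigm;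
NOT a claim that NS blows up.

WHAT. In part 14 §42's co-rotating frame (`Φ = (C - C(r))/ρ²`, `C' = c`,
`p = cos Φ·a + sin Φ·d`, `q = cos Φ·d - sin Φ·a`, `p² + q² = a² + d² ≤ 1`) the transfer
coordinate obeys the LINEAR equation
  `q' = -(Kã cos²Φ)·q + sin Φ·(εab + σac - Kã cos Φ·p)`,  `σ = ρ²e^{-M}`:
a damping (`Kã cos²Φ ≥ 0`) and a forcing that carries the factor `sin Φ`. §233
`corot_transfer_law` is its variation-of-constants bound (conjugation by `e^{∫Kã cos²Φ}` as
in part 77 §228 — the damping can only help, there is NO amplification factor): with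
`|b| ≤ β₁` on `[r, T]` and any majorant `W' ≥ |sin Φ|`,
  `|d(T)| ≤ |d(r)| + |sin Φ(T)| + (εβ₁ + σ + Kã(T))·(W(T) - W(r))`
(`d = sin Φ·p + cos Φ·q`, `|p| ≤ 1`). §234 `knob_transfer_exit_fine` reads it on a pinned
lattice pulse at the data of part 75 §226 (normal-form ignition, pulse `≤ 242/K⁹` on the kept
ring, live trigger, clock reversed at the exit, `|Φ(T') - kπ| ≤ δ`) with the phase weight of
part 78 §231–§232 (`|b| ≤ 2ε` on the kept ring):
  `|d(T')| ≤ |d(r)| + δ + (2ε² + ρ²e^{-K¹⁰} + Kã(T'))·((0.45k + 3.4)/K¹⁰ + 242δ/K⁹)`.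

WHY (the d-ledger, SPEC-INPUT-bp1 §BJ/§BK). This is the PULSE half of the recursion whose
COLD half is part 77 §229: along the clean ladder `r₀ < T'₀ < r₁ < …` (`d_n = |d(r_n)|`),
  `d_{n+1} ≤ e^{-(9/4)Kã(T'_n)}·(d_n + δ + (2ε² + σ + Kã(T'_n))·w) + 3/K⁹`,
`w = O(k/K¹⁰ + δ/K⁹)`, and since `x·e^{-(9/4)x} ≤ 4/(9e)` the injection is `O(k/K⁹ + δ)`
uniformly in the output level: `d_n ≤ d_0 + O(1/K)` always. It SUPERSEDES the design note
§BJ (D0): part 14 §43's amplification factor `1 + 242Kã/K⁹` is an artefact of bounding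
`|q| ≤ 1` inside the forcing; the exact equation is linear in `q` with a non-negative
damping, so no Gronwall factor arises and part 77 §230 is not needed by the ledger. Aimed
at, not proved here: the rung theorem with the `d`-conjunct, the ledger along the ladder,
the log-free per-rung ceiling.

HONEST LIMITS. (i) upper bounds on `|d|` only — no sign, no lower bound, nothing new about
`a`; (ii) §234's data (ignition levels, kept ring, live trigger, reversed clock, pin) are
HYPOTHESES, discharged by parts 52/56/65/71/73 only at THEIR data — this file does not
re-prove a rung; (iii) the factor `2ε² + σ` is not simplified away (on the rung regime
`ε² ≤ 1/(6K²⁰)` it is below `10⁻⁶/K¹⁹`); (iv) the swing contributes through its bare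
length; (v) nothing about Navier–Stokes.
[cite: Tao2016AveragedNS, §5.5 Theorem 5.3, (5.5), (5.6), (b-eq), (c-eq), (d-eq), (ta-eq),
(energy-con), (est)]
-/

noncomputable section

namespace Summit.NavierStokesRegularity.FluidComputer.GateBudget

open Real Set Filter Topology
open Literature.Analysis.FluidPDE.Tao2016AveragedNS

variable {K M ε ρ : ℝ} {X : ℝ → Fin 5 → ℝ} {C : ℝ → ℝ}

/-! ## §233 The linear law of the co-rotating transfer coordinate -/

/-- §233 **THE CO-ROTATING TRANSFER LAW** (any member from `delayInit`, `ε, K ≥ 0`, any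
primitive `C` of the trigger, `0 ≤ r ≤ T`). With the dose phase `Φ = (C - C(r))/ρ²`, a clock
bound `|b| ≤ β₁` on `[r, T]` and any majorant `W` of the phase weight (`W' = w ≥ |sin Φ|` on
`[r, T]`): `|d(T)| ≤ |d(r)| + |sin Φ(T)| + (εβ₁ + ρ²e^{-M} + Kã(T))·(W(T) - W(r))`.
Mechanism: the co-rotating transfer coordinate `q = cos Φ·d - sin Φ·a` (part 14 §42) obeys the
LINEAR equation `q' = -Kã cos²Φ·q + sin Φ·(εab + ρ²e^{-M}ac - Kã cos Φ·p)`, `p = cos Φ·a +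
sin Φ·d`, `|p| ≤ 1`: a damping and a forcing carrying the factor `sin Φ`; conjugating by
`e^{∫Kã cos²Φ}` (variation of constants, as part 77 §228) gives `|q(T)| ≤ |d(r)| + L·∫|sin Φ|`,
and `d = sin Φ·p + cos Φ·q`. [derived: part 14 §42 `hasDerivAt_corot_q`; this file] -/
theorem corot_transfer_law (hX : ∀ t, HasDerivAt X (RotorKnob.rotorCircuit K M ε ρ (X t)) t)
    (h0 : X 0 = delayInit) (hC : ∀ t, HasDerivAt C (X t 2) t) (hε : 0 ≤ ε) (hK : 0 ≤ K)
    {r T β₁ : ℝ} {W w : ℝ → ℝ} (hr : 0 ≤ r) (hrT : r ≤ T)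
    (hb : ∀ s ∈ Icc r T, |X s 1| ≤ β₁) (hW : ∀ s ∈ Icc r T, HasDerivAt W (w s) s)
    (hw : ∀ s ∈ Icc r T, |sin ((C s - C r) / ρ ^ 2)| ≤ w s) :
    |X T 3| ≤ |X r 3| + |sin ((C T - C r) / ρ ^ 2)|
      + (ε * β₁ + ρ ^ 2 * exp (-M) + K * X T 4) * (W T - W r) := by
  have hrI : r ∈ Icc r T := left_mem_Icc.2 hrT
  have hTI : T ∈ Icc r T := right_mem_Icc.2 hrT
  have hσ0 : 0 ≤ ρ ^ 2 * exp (-M) := by positivity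
  have hβ0 : 0 ≤ β₁ := (abs_nonneg _).trans (hb r hrI)
  have heT : 0 ≤ X T 4 := RotorKnob.e_nonneg hX h0 hK (hr.trans hrT)
  have hmonoE := RotorKnob.rotorCircuit_output_monotone hK hX
  set L : ℝ := ε * β₁ + ρ ^ 2 * exp (-M) + K * X T 4 with hL_def
  have hL0 : 0 ≤ L := add_nonneg (add_nonneg (mul_nonneg hε hβ0) hσ0) (mul_nonneg hK heT)
  -- the dose phase
  have hCc : Continuous C := continuous_iff_continuousAt.2 fun t => (hC t).continuousAt
  set Φ : ℝ → ℝ := fun s => (C s - C r) / ρ ^ 2 with hΦ_def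
  have hΦc : Continuous Φ := (hCc.sub continuous_const).div_const _
  have hΦr : Φ r = 0 := by simp [hΦ_def]
  -- the damping coefficient `κ = Kã cos²Φ ≥ 0` and the integrating exponent `P = ∫_r κ`
  set κ : ℝ → ℝ := fun s => K * X s 4 * cos (Φ s) ^ 2 with hκ_def
  have hκc : Continuous κ :=
    (continuous_const.mul (RotorKnob.continuous_traj hX 4)).mul ((continuous_cos.comp hΦc).pow 2)
  set P : ℝ → ℝ := fun s => ∫ u in r..s, κ u with hP_def
  have hP : ∀ s, HasDerivAt P (κ s) s := fun s => (hκc.integral_hasStrictDerivAt r s).hasDerivAt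
  have hP0 : P r = 0 := by simp [hP_def]
  have hκ0 : ∀ s ∈ Icc r T, 0 ≤ κ s := fun s hs =>
    mul_nonneg (mul_nonneg hK (RotorKnob.e_nonneg hX h0 hK (hr.trans hs.1))) (sq_nonneg _)
  have hPmono := Thm53.monotoneOn_sub_of_le_deriv (f := P) (f' := κ) (Φ := fun _ => (0 : ℝ))
    (φ := fun _ => (0 : ℝ)) (convex_Icc r T) (fun s _ => hP s)
    (fun s _ => hasDerivAt_const s (0 : ℝ)) (fun s hs => hκ0 s hs)
  have hPle : ∀ s ∈ Icc r T, P s ≤ P T := fun s hs => by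
    have h := hPmono hs hTI hs.2
    simpa using h
  have hPT : 0 ≤ P T := by
    have h := hPle r hrI
    rwa [hP0] at h
  -- the co-rotating transfer coordinate `q` and the conjugated mode `G = q·e^{P}`
  set q : ℝ → ℝ := fun s => cos (Φ s) * X s 3 - sin (Φ s) * X s 0 with hq_def
  have hq : ∀ s, HasDerivAt q (sin (Φ s) * (ε * X s 0 * X s 1 + ρ ^ 2 * exp (-M) * X s 0 * X s 2)
      + -cos (Φ s) * (K * X s 3 * X s 4)) s := fun s => hasDerivAt_corot_q hX hC r s
  set G : ℝ → ℝ := fun s => q s * exp (P s) with hG_def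
  set G' : ℝ → ℝ := fun s =>
    (sin (Φ s) * (ε * X s 0 * X s 1 + ρ ^ 2 * exp (-M) * X s 0 * X s 2)
      + -cos (Φ s) * (K * X s 3 * X s 4)) * exp (P s) + q s * (exp (P s) * κ s) with hG'_def
  have hG : ∀ s, HasDerivAt G (G' s) s := fun s => (hq s).mul (hP s).exp
  set Cb : ℝ := L * exp (P T) with hCb_def
  have hCb0 : 0 ≤ Cb := mul_nonneg hL0 (exp_pos _).le
  -- `|G'| ≤ Cb·w`: the forcing carries `sin Φ`, the damping is absorbed by the conjugation
  have hbd : ∀ s ∈ Icc r T, |G' s| ≤ Cb * w s := by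
    intro s hs
    have hs0 : 0 ≤ s := hr.trans hs.1
    have ha := RotorKnob.traj_abs_le_one hX h0 s 0
    have hc := RotorKnob.traj_abs_le_one hX h0 s 2
    have hes : 0 ≤ X s 4 := RotorKnob.e_nonneg hX h0 hK hs0
    have heT' : X s 4 ≤ X T 4 := hmonoE hs.2
    have hws : |sin (Φ s)| ≤ w s := hw s hs
    -- the linear structure: `q' + κq = sin Φ·(E - Kã cos Φ·p)`
    set p : ℝ := cos (Φ s) * X s 0 + sin (Φ s) * X s 3 with hp_def
    set E : ℝ := ε * X s 0 * X s 1 + ρ ^ 2 * exp (-M) * X s 0 * X s 2 with hE_def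
    have hid : G' s = sin (Φ s) * (E - K * X s 4 * cos (Φ s) * p) * exp (P s) := by
      simp only [hG'_def, hq_def, hκ_def, hp_def, hE_def]
      linear_combination (K * X s 4 * cos (Φ s) * X s 3 * exp (P s)) * sin_sq_add_cos_sq (Φ s)
    -- `|p| ≤ 1`
    have hpq : p ^ 2 + q s ^ 2 = X s 0 ^ 2 + X s 3 ^ 2 := by
      simp only [hp_def, hq_def]
      linear_combination (X s 0 ^ 2 + X s 3 ^ 2) * sin_sq_add_cos_sq (Φ s)
    have had : X s 0 ^ 2 + X s 3 ^ 2 ≤ 1 := by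
      linarith [RotorKnob.traj_sum_sq_eq_one hX h0 s, sq_nonneg (X s 1), sq_nonneg (X s 2),
        sq_nonneg (X s 4)]
    have hp1 : |p| ≤ 1 := (sq_le_one_iff_abs_le_one p).1 (by nlinarith [sq_nonneg (q s)])
    -- `|E| ≤ εβ₁ + ρ²e^{-M}`
    have hE : |E| ≤ ε * β₁ + ρ ^ 2 * exp (-M) := by
      have h1 : |ε * X s 0 * X s 1| ≤ ε * β₁ := by
        rw [abs_mul, abs_mul, abs_of_nonneg hε]
        calc ε * |X s 0| * |X s 1| ≤ ε * 1 * β₁ := by gcongr; exact hb s hs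
          _ = ε * β₁ := by ring
      have h2 : |ρ ^ 2 * exp (-M) * X s 0 * X s 2| ≤ ρ ^ 2 * exp (-M) := by
        rw [abs_mul, abs_mul, abs_of_nonneg hσ0]
        calc ρ ^ 2 * exp (-M) * |X s 0| * |X s 2| ≤ ρ ^ 2 * exp (-M) * 1 * 1 := by gcongr
          _ = ρ ^ 2 * exp (-M) := by ring
      exact (abs_add_le _ _).trans (add_le_add h1 h2)
    have hKp : |K * X s 4 * cos (Φ s) * p| ≤ K * X T 4 := by
      rw [abs_mul, abs_mul, abs_mul, abs_of_nonneg hK, abs_of_nonneg hes]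
      calc K * X s 4 * |cos (Φ s)| * |p| ≤ K * X T 4 * 1 * 1 := by
            gcongr
            exact abs_cos_le_one _
        _ = K * X T 4 := by ring
    have hin : |E - K * X s 4 * cos (Φ s) * p| ≤ L :=
      (abs_sub _ _).trans (by rw [hL_def]; exact add_le_add hE hKp)
    have hee : exp (P s) ≤ exp (P T) := exp_le_exp.2 (hPle s hs)
    rw [hid, abs_mul, abs_mul, abs_of_pos (exp_pos (P s)), hCb_def]
    have hw0 : 0 ≤ w s := (abs_nonneg _).trans hws
    calc |sin (Φ s)| * |E - K * X s 4 * cos (Φ s) * p| * exp (P s)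
        ≤ w s * L * exp (P T) :=
          mul_le_mul (mul_le_mul hws hin (abs_nonneg _) hw0) hee (exp_pos _).le
            (mul_nonneg hw0 hL0)
      _ = L * exp (P T) * w s := by ring
  -- comparison: `G ∓ Cb·W` are antitone / monotone on `[r, T]`
  have hanti := Thm53.antitoneOn_sub_of_deriv_le (f := G) (f' := G') (Φ := fun s => Cb * W s)
    (φ := fun s => Cb * w s) (convex_Icc r T) (fun s _ => hG s)
    (fun s hs => (hW s hs).const_mul Cb) (fun s hs => (abs_le.1 (hbd s hs)).2)
  have hmono := Thm53.monotoneOn_sub_of_le_deriv (f := G) (f' := G') (Φ := fun s => -(Cb * W s))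
    (φ := fun s => -(Cb * w s)) (convex_Icc r T) (fun s _ => hG s)
    (fun s hs => ((hW s hs).const_mul Cb).neg) (fun s hs => (abs_le.1 (hbd s hs)).1)
  have hGr : G r = X r 3 := by simp [hG_def, hq_def, hΦr, hP0]
  have hup : G T ≤ X r 3 + Cb * (W T - W r) := by
    have h := hanti hrI hTI hrT
    simp only [hGr] at h
    linarith
  have hlo : X r 3 - Cb * (W T - W r) ≤ G T := by
    have h := hmono hrI hTI hrT
    simp only [hGr] at h
    linarith
  have hGabs : |q T| * exp (P T) ≤ |X r 3| + Cb * (W T - W r) := by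
    have e : |q T| * exp (P T) = |G T| := by
      simp only [hG_def, abs_mul, abs_of_pos (exp_pos (P T))]
    rw [e]
    exact abs_le.2 ⟨by linarith [neg_abs_le (X r 3)], by linarith [le_abs_self (X r 3)]⟩
  -- undo the conjugation: `|q(T)| ≤ |d(r)| + L·(W(T) - W(r))`
  have e1 : exp (P T) * exp (-P T) = 1 := by rw [← exp_add, add_neg_cancel, exp_zero]
  have hexp1 : exp (-P T) ≤ 1 := exp_le_one_iff.2 (by linarith)
  have hqT : |q T| ≤ |X r 3| + L * (W T - W r) := by
    calc |q T| = |q T| * exp (P T) * exp (-P T) := by rw [mul_assoc, e1, mul_one]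
      _ ≤ (|X r 3| + Cb * (W T - W r)) * exp (-P T) :=
          mul_le_mul_of_nonneg_right hGabs (exp_pos _).le
      _ = |X r 3| * exp (-P T) + L * (W T - W r) * (exp (P T) * exp (-P T)) := by
          rw [hCb_def]; ring
      _ = |X r 3| * exp (-P T) + L * (W T - W r) := by rw [e1, mul_one]
      _ ≤ |X r 3| * 1 + L * (W T - W r) := by
          gcongr
      _ = |X r 3| + L * (W T - W r) := by ring
  -- back to the transfer mode: `d = sin Φ·p + cos Φ·q`
  have hpT : |cos (Φ T) * X T 0 + sin (Φ T) * X T 3| ≤ 1 := by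
    have hpq : (cos (Φ T) * X T 0 + sin (Φ T) * X T 3) ^ 2 + q T ^ 2 = X T 0 ^ 2 + X T 3 ^ 2 := by
      simp only [hq_def]
      linear_combination (X T 0 ^ 2 + X T 3 ^ 2) * sin_sq_add_cos_sq (Φ T)
    have had : X T 0 ^ 2 + X T 3 ^ 2 ≤ 1 := by
      linarith [RotorKnob.traj_sum_sq_eq_one hX h0 T, sq_nonneg (X T 1), sq_nonneg (X T 2),
        sq_nonneg (X T 4)]
    exact (sq_le_one_iff_abs_le_one _).1 (by nlinarith [sq_nonneg (q T)])
  have hdec : X T 3 = sin (Φ T) * (cos (Φ T) * X T 0 + sin (Φ T) * X T 3) + cos (Φ T) * q T := by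
    simp only [hq_def]
    linear_combination (-(X T 3)) * sin_sq_add_cos_sq (Φ T)
  have hfin : |X T 3| ≤ |sin (Φ T)| + |q T| := by
    rw [hdec]
    calc |sin (Φ T) * (cos (Φ T) * X T 0 + sin (Φ T) * X T 3) + cos (Φ T) * q T|
        ≤ |sin (Φ T) * (cos (Φ T) * X T 0 + sin (Φ T) * X T 3)| + |cos (Φ T) * q T| :=
          abs_add_le _ _
      _ = |sin (Φ T)| * |cos (Φ T) * X T 0 + sin (Φ T) * X T 3| + |cos (Φ T)| * |q T| := by
          rw [abs_mul, abs_mul]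
      _ ≤ |sin (Φ T)| * 1 + 1 * |q T| :=
          add_le_add (mul_le_mul_of_nonneg_left hpT (abs_nonneg _))
            (mul_le_mul_of_nonneg_right (abs_cos_le_one _) (abs_nonneg _))
      _ = |sin (Φ T)| + |q T| := by ring
  show |X T 3| ≤ |X r 3| + |sin (Φ T)| + L * (W T - W r)
  linarith

/-! ## §234 The transfer mode at the exit of a pinned lattice pulse -/
/-- §234 **THE FINE TRANSFER LAW AT THE PULSE EXIT** (headline member `M = K¹⁰`, `K ≥ 16`,
lattice `ε = kK¹⁰ρ²` in the window `K¹⁰ρ² ≤ 2ε`). At the data of part 75 §226 — a normal-form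
ignition `r ≥ 0` (`b(r) = θε`, `θ ∈ [5/4, 3/2]`, `c(r) = ρ²/K⁹`), a pulse `[r, T']` of length
`≤ 242/K⁹` on the kept ring with the trigger alive, the clock reversed at `T'`
(`b(T') ≤ -(31/32)θε`) and the exit phase pinned (`|Φ(T') - kπ| ≤ δ`):
`|d(T')| ≤ |d(r)| + δ + (2ε² + ρ²e^{-K¹⁰} + Kã(T'))·((0.45k + 3.4)/K¹⁰ + 242δ/K⁹)`.
The transfer mode crosses the pulse ADDITIVELY: no amplification factor, and the drift is
weighted by `∫|sin Φ| = O(k/K¹⁰)` (climb / swing / fall of part 73 §223, weights part 78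
§231–§232) instead of the pulse length.
[derived: this file §233; part 78 §231–§232; part 73 §223 `pulse_clock_phases`] -/
theorem knob_transfer_exit_fine
    (hX : ∀ t, HasDerivAt X (RotorKnob.rotorCircuit K (K ^ 10) ε ρ (X t)) t)
    (h0 : X 0 = delayInit) (hC : ∀ t, HasDerivAt C (X t 2) t) (hK : 16 ≤ K) (hε : 0 < ε)
    (hρ : 0 < ρ) (hhi : K ^ 10 * ρ ^ 2 ≤ 2 * ε) (k : ℕ) (hk : ε = k * K ^ 10 * ρ ^ 2)
    {r T' θ δ : ℝ} (hr : 0 ≤ r) (hrT : r ≤ T') (hτ : T' - r ≤ 242 / K ^ 9) (hθ1 : 5 / 4 ≤ θ)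
    (hθ2 : θ ≤ 3 / 2) (hbr : X r 1 = θ * ε) (hcr : X r 2 = ρ ^ 2 / K ^ 9)
    (hkept : ∀ t ∈ Icc r T', |X t 1 ^ 2 + X t 2 ^ 2 - (X r 1 ^ 2 + X r 2 ^ 2)| ≤ ε ^ 2 / 10 ^ 6)
    (hpos : ∀ t ∈ Icc r T', 0 < X t 2) (hbT : X T' 1 ≤ -(31 / 32 * θ * ε))
    (hpin : |(C T' - C r) / ρ ^ 2 - k * π| ≤ δ) :
    |X T' 3| ≤ |X r 3| + δ + (2 * ε ^ 2 + ρ ^ 2 * exp (-K ^ 10) + K * X T' 4)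
      * ((0.45 * k + 3.4) / K ^ 10 + 242 * δ / K ^ 9) := by
  have hK0 : (0 : ℝ) ≤ K := by linarith
  have hKp : (0 : ℝ) < K := by linarith
  have hK10 : (0 : ℝ) < K ^ 10 := by positivity
  have hθ0 : 0 < θ := by linarith
  have hδ : 0 ≤ δ := (abs_nonneg _).trans hpin
  obtain ⟨σ, hσ⟩ : ∃ σ : ℝ, σ = ρ ^ 2 * exp (-K ^ 10) := ⟨_, rfl⟩
  have hσ0 : 0 ≤ σ := by rw [hσ]; positivity
  -- the clock stays `O(ε)` on the pulse: `|b| ≤ 2ε`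
  have hb' : ∀ s ∈ Icc r T', |X s 1| ≤ 2 * ε := by
    have h2 : (2 : ℝ) ≤ K ^ 10 :=
      le_trans (by norm_num : (2 : ℝ) ≤ 16 ^ 10) (pow_le_pow_left₀ (by norm_num) hK 10)
    have hρε : ρ ^ 2 ≤ ε := by linarith [mul_le_mul_of_nonneg_right h2 (sq_nonneg ρ)]
    have hρK : ρ ^ 2 / K ^ 9 ≤ ε :=
      (div_le_self (sq_nonneg ρ) (one_le_pow₀ (by linarith))).trans hρε
    have hcr2 : X r 2 ^ 2 ≤ ε ^ 2 := by
      rw [hcr]; exact pow_le_pow_left₀ (by positivity) hρK 2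
    have hbr2 : X r 1 ^ 2 ≤ (3 / 2 * ε) ^ 2 := by
      rw [hbr]; exact pow_le_pow_left₀ (by positivity) (mul_le_mul_of_nonneg_right hθ2 hε.le) 2
    intro s hs'
    have h1 := (abs_le.1 (hkept s hs')).2
    have hb2 : X s 1 ^ 2 ≤ (2 * ε) ^ 2 := by linarith [sq_nonneg (X s 2), sq_nonneg ε]
    exact abs_le.2 (abs_le_of_sq_le_sq' hb2 (by positivity))
  -- lattice facts: `k ≥ 1`, `kρ² = ε/K¹⁰`, so `kσ ≤ ε/K¹⁰`
  obtain ⟨hk0, -, -⟩ := lattice_phase_unit (μ := ε⁻¹ * K ^ 10) hK0 hε hk rfl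
  have hkne : k ≠ 0 := by rintro rfl; simp at hk0
  have hk1 : (1 : ℝ) ≤ k := by exact_mod_cast Nat.one_le_iff_ne_zero.2 hkne
  have hkρ : (k : ℝ) * ρ ^ 2 = ε / K ^ 10 := by
    rw [hk]; field_simp
  have hs0 : 0 ≤ (k : ℝ) * σ := mul_nonneg k.cast_nonneg hσ0
  have hs : (k : ℝ) * σ ≤ ε / K ^ 10 := by
    rw [← hkρ, hσ]
    have h1 : exp (-K ^ 10) ≤ 1 := exp_le_one_iff.2 (by linarith [hK10.le])
    calc (k : ℝ) * (ρ ^ 2 * exp (-K ^ 10)) = k * ρ ^ 2 * exp (-K ^ 10) := by ring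
      _ ≤ k * ρ ^ 2 * 1 := mul_le_mul_of_nonneg_left h1 (by positivity)
      _ = k * ρ ^ 2 := mul_one _
  -- the three clock phases of the pulse (part 73 §223)
  obtain ⟨t₁, t₂, hrt₁, ht₁₂, ht₂T, hb1, hc1, -, hsw, hc2, hb2⟩ :=
    pulse_clock_phases hX h0 hK hε hρ hhi hrT hτ hθ1 hbr hcr hkept hpos hbT
  have hct₁ : X t₁ 2 ≤ θ * ε / 4 :=
    (abs_le_of_sq_le_sq' (by rw [show (θ * ε / 4) ^ 2 = θ ^ 2 * ε ^ 2 / 16 by ring]; exact hc1)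
      (by positivity)).2
  have hct₂ : X t₂ 2 ≤ θ * ε / 4 :=
    (abs_le_of_sq_le_sq' (by rw [show (θ * ε / 4) ^ 2 = θ ^ 2 * ε ^ 2 / 16 by ring]; exact hc2)
      (by positivity)).2
  -- the phase weight `W = ∫_r |sin Φ|`
  have hCc : Continuous C := continuous_iff_continuousAt.2 fun t => (hC t).continuousAt
  have hwc : Continuous fun u => |sin ((C u - C r) / ρ ^ 2)| :=
    continuous_abs.comp (continuous_sin.comp ((hCc.sub continuous_const).div_const _))
  set W : ℝ → ℝ := fun s => ∫ u in r..s, |sin ((C u - C r) / ρ ^ 2)| with hW_def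
  have hW : ∀ s, HasDerivAt W (|sin ((C s - C r) / ρ ^ 2)|) s := fun s =>
    (hwc.integral_hasStrictDerivAt r s).hasDerivAt
  -- climb, swing, fall
  have hWc := weight_climb hX h0 hC hK0 hε k hk hr hrt₁.le (β := 31 / 32 * θ * ε)
    (by positivity) hb1 (fun u _ => hW u)
  have hWs : W t₂ - W t₁ ≤ t₂ - t₁ := by
    have h := Thm53.antitoneOn_sub_of_deriv_le (f := W)
      (f' := fun u => |sin ((C u - C r) / ρ ^ 2)|) (Φ := fun u => u) (φ := fun _ => (1 : ℝ))
      (convex_Icc t₁ t₂) (fun u _ => hW u) (fun u _ => hasDerivAt_id' u)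
      (fun u _ => abs_sin_le_one _) (left_mem_Icc.2 ht₁₂.le) (right_mem_Icc.2 ht₁₂.le) ht₁₂.le
    dsimp only at h
    linarith
  have hWf := weight_fall hX h0 hC hK0 hε k hk hr (hrt₁.le.trans ht₁₂.le) ht₂T
    (β' := 15 / 16 * θ * ε) (by positivity) (fun u hu => hb2 u hu) hpin (fun u _ => hW u)
  rw [← hσ] at hWf
  -- bound the three pieces by the numerics
  have hcr0 : 0 ≤ X r 2 := by rw [hcr]; positivity
  have hcT0 : 0 ≤ X T' 2 := (hpos T' (right_mem_Icc.2 hrT)).le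
  have hden1 : 0 < ε⁻¹ * K ^ 10 * (31 / 32 * θ * ε) ^ 2 := by positivity
  have hden2 : 0 < ε⁻¹ * K ^ 10 * (15 / 16 * θ * ε) ^ 2 := by positivity
  have hWc' : W t₁ - W r ≤ k * (θ * ε / 4) / (ε⁻¹ * K ^ 10 * (31 / 32 * θ * ε) ^ 2) := by
    refine hWc.trans (div_le_div_of_nonneg_right ?_ hden1.le)
    linarith [mul_le_mul_of_nonneg_left hct₁ hk0.le, mul_nonneg hk0.le hcr0]
  have hWf' : W T' - W t₂ ≤ (δ + k * σ * (T' - r) / (15 / 16 * θ * ε)) * (T' - t₂)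
      + (k * σ * (T' - t₂) + k * (θ * ε / 4)) / (ε⁻¹ * K ^ 10 * (15 / 16 * θ * ε) ^ 2) := by
    refine hWf.trans (add_le_add le_rfl (div_le_div_of_nonneg_right ?_ hden2.le))
    linarith [mul_le_mul_of_nonneg_left hct₂ hk0.le, mul_nonneg hk0.le hcT0]
  have hnum := weight_numerics hK hε hθ1 hk1 hδ hs0 hs (s := k * σ) (τ := T' - r)
    (τ₂ := T' - t₂) (by linarith) (by linarith) hτ
  have hsw' : t₂ - t₁ ≤ 4.16 / (θ * K ^ 10) := hsw
  have hWsum : W T' - W r ≤ (0.45 * k + 3.4) / K ^ 10 + 242 * δ / K ^ 9 := by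
    linarith [hWc', hWs, hWf', hnum, hsw']
  -- the co-rotating transfer law (§233) with `w = |sin Φ|`
  have hA := corot_transfer_law hX h0 hC hε.le hK0 hr hrT hb' (fun s _ => hW s)
    (fun s _ => le_rfl)
  -- the pinned exit: `|sin Φ(T')| ≤ δ`
  have hsinT : |sin ((C T' - C r) / ρ ^ 2)| ≤ δ := by
    obtain ⟨x, hx⟩ : ∃ x : ℝ, x = (C T' - C r) / ρ ^ 2 - k * π := ⟨_, rfl⟩
    have e : (C T' - C r) / ρ ^ 2 = x + k * π := by rw [hx]; ring
    have hxδ : |x| ≤ δ := by rw [hx]; exact hpin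
    rw [e, sin_add_nat_mul_pi, abs_mul, abs_pow, abs_neg, abs_one, one_pow, one_mul]
    exact abs_sin_le_abs.trans hxδ
  have hL0 : 0 ≤ ε * (2 * ε) + ρ ^ 2 * exp (-K ^ 10) + K * X T' 4 :=
    add_nonneg (add_nonneg (by positivity) (by positivity))
      (mul_nonneg hK0 (RotorKnob.e_nonneg hX h0 hK0 (hr.trans hrT)))
  have hmain := mul_le_mul_of_nonneg_left hWsum hL0
  linarith [hA, hsinT, hmain]

end Summit.NavierStokesRegularity.FluidComputer.GateBudget
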